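import Summits.HodgeConjecture.HodgeConjecture.Theorems.Ring2AbelianAllAndreIsogenousEllipticAnchors
import Literature.AlgebraicGeometry.ComplexMultiplication.EndomorphismFieldNondegenerateType
import HarnessLib

/-!
# Ring 2 · sub-cell AbelianAll (ALL ABELIAN VARIETIES), André axis, part N — WHICH CM ANCHORS NEED `HC_CM`: a member (or chart) that is
# STABLY NONDEGENERATE (Gordon: `Hdg(Aᵏ) = Div(Aᵏ)` for all `k`), or isogenous to a power of one, anchors the pencil WITH NO `HC_CM`;
# `B⋆` of the total space then PROVES the Hodge conjecture for the invariant classes / the Weil plane of EVERY member, fact-free;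
# instance: powers of a prime-dimensional abelian variety with a CM field of full degree (Tankeev–Ribet–Yanai, a tree theorem)

HONEST FRAMING (page 1, verbatim): **research route, not a corollary; conditional on HC_CM plus one named
minimal statement.** Cell line: research route conditional on HC_CM; not a corollary; Q11.4-sentence-2
already refuted in dim ≥ 3. Nothing in this file proves a case of the Hodge conjecture or of `B(X)` for a named `X`: every row is an IMPLICATION or an
EQUIVALENCE between displayed hypotheses; the Hodge conjecture AT THE ANCHOR is a KNOWN case, imported from the tree's Literature layer
(`IsStablyNondegenerate.hodgeConjectureFor`: Lefschetz `(1,1)` and products of divisors). `HC_CM`, `HC_AV` and the global nodes do NOT occur.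
NAMED-FACT BINDER: `hGT` = Verdier 1976 (the ⟸ halves only; §2 (a) / §3 (a)–(b) / §4 (b) are fact-free). Item `Theses.RankFourFaces.CMToAbelian`
(stmt-16267) stays OPEN; N104 untouched; no node is born (0 `def`, 0 `sorry`). Seat `pub-hodge-ring2-ab-andre-2`, gen 44 (part N).

## Content (theorems only; standard axioms)

Parts M-c / M-d / M-e anchored a compact abelian pencil at a member satisfying the Hodge conjecture: a CM member GRANTED `HC_CM`, or a member
isogenous to a power of an elliptic curve (fact-free). This file names the class of anchors that need no `HC_CM`: `IsStablyNondegenerate` (Gordon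
Def. 7.6 / Thm. 7.5 (1), Moonen–Zarhin's condition (D): the Hodge ring of every power is generated by divisors — a tree predicate with
`IsStablyNondegenerate.hodgeConjectureFor(_of_isIsogenous_powSucc)`, UNCONDITIONAL), and records the ONE-WAY rows without Verdier.
* §1 `hodgeConjectureFor_fiberOver_of_isStablyNondegenerate_chart`, `…_of_isIsogenous_powSucc_of_isStablyNondegenerate` (fact-free transfers).
* §2 general pencils: (a) **`forall_map_fiberι_mem_algebraicClasses_of_lefschetzB_of_stablyNondegenerateMember`** (FACT-FREE, no θ_N, no group
  law, no Verdier): `B⋆(𝒳, η) ∀η` on a compact abelian pencil through a member charted by a stably nondegenerate `B` (invariants of Hodge type there)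
  ⟹ the invariant classes are ALGEBRAIC ON EVERY MEMBER; (b) **`lefschetzB_pencil_iff_forall_algebraicInvariants_of_stablyNondegenerateMember_of_verdier`**
  and (c) `…_of_isIsogenous_powSucc_stablyNondegenerateMember_…` — the anchored exactness of part M-c with the anchor «stably nondegenerate (up to
  isogeny and powers)», no `HC_CM`.
* §3 Weil pencils with their `K`-action (data of part M-d §2): (a) **`weilClassesOf_le_algebraicClasses_forall_of_lefschetzB_of_hodgeConjectureFor_chart`**
  (FACT-FREE): `B⋆(𝒳, η) ∀η` + ONE chart satisfying the Hodge conjecture ⟹ `W(A_s, φ_s) ⊆ Nⁿ(A_s)` for EVERY member — the ⟹ half of part M-d §3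
  with its minimal hypotheses (no θ_N, no group law, no rank data, no Verdier); (b) the same from a stably nondegenerate chart; (c)–(d) the
  equivalences `lefschetzB_weilPencil_iff_forall_weilClasses_algebraic_of_stablyNondegenerateChart_of_verdier` / `…_of_isIsogenous_powSucc_…`.
* §4 THE INSTANCE: a chart isogenous to a power `P^{N+1}` of an abelian variety `P` of PRIME dimension `p` with a number field of degree `2p` in
  `End_ℚ(P)` (the tree's `EndFieldFullDegree.isStablyNondegenerate_of_prime`: Yanai + Hazama, Tate–Murasaki for `Eᵖ`; no simplicity hypothesis):
  (a) `lefschetzB_weilPencil_iff_forall_weilClasses_algebraic_of_primeCMPowerChart_of_verdier`, (b) the fact-free ⟹ row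
  `weilClassesOf_le_algebraicClasses_forall_of_lefschetzB_of_primeCMPowerChart`, (c) the general-pencil equivalence.

## Why this matters / honest status

On André's Lemme 6.3.1 pencils the CM anchor needs `HC_CM` EXACTLY when it is stably degenerate (exceptional Hodge classes on some power); at a
stably nondegenerate anchor the exactness «`B⋆` of the total space ⟺ HC for the invariant classes of every member» is UNCONDITIONAL (modulo
Verdier for ⟸), and the ⟹ half is fact-free. For the open W₆ instance (RING2-MAP §AbelianAll: `B⋆` of the 7-fold total space of a compact pencil
of NON-split `ℚ(√−d_K)`-Weil sixfolds): a CM member of a Weil family is Mumford–Tate-degenerate, but it may well be STABLY NONDEGENERATE as a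
variety — e.g. `B × B̄ ≅ B²` for a SIMPLE CM abelian THREEFOLD `B` (prime dimension, §4), which carries `K`-Weil structures `(3,3)` of NON-split
class for suitable product polarizations (exact seat bookkeeping of the sister cell pub-hsemireg, `target-g6/CM-ANCHORS-g6.md` §4.1: `B = J(y³ = x⁴ − x)`,
`K = ℚ(√−3)`; `B₇ = J(y² = x⁷ − 1)`, `K = ℚ(√−7)` — NOT print, NOT a kernel statement, quoted as a pointer only), or `E⁶` for a CM elliptic curve
(RING2-MAP AA2.361). On every compact pencil with `K`-action through such a member, §4 (b) reads: **`B⋆` of the ONE 7-fold ⟹ the Weil Hodge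
conjecture for EVERY member — no `HC_CM`, no [Markman2025], no Verdier.** Neither side is claimed; strength and node level unchanged (the ⟸ half
is Weil-HC along the whole pencil, [Tankeev2008]); nothing minimal claimed; N104 untouched. EDGE LABELS: §1, §2 (a), §3 (a)–(b), §4 (b) K (fact-free);
§2 (b)–(c), §3 (c)–(d), §4 (a), (c) K (⟹) / K[Verdier] (⟸).
References: Gordon1999HodgeAVSurvey (6.3–6.4, 7.6, §3); MoonenZarhin1999LowDim (§2 (D)); Yanai1985; Andre1996Motifs (6.3.1, 6.3.3); vanGeemen1994HodgeAV; Tankeev2008; Verdier1976.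
-/

noncomputable section

set_option linter.dupNamespace false

namespace Summit.HodgeConjecture.HodgeConjecture.Ring2.AbelianAll

open CategoryTheory CategoryTheory.Limits AlgebraicGeometry MonoidalCategory CartesianMonoidalCategory
open Literature.AlgebraicGeometry Literature.AlgebraicGeometry.Motives
open Literature.AlgebraicGeometry.HodgeTheory Literature.AlgebraicGeometry.VanGeemen1994
open Literature.AlgebraicGeometry.ComplexMultiplication (EndFieldFullDegree.isStablyNondegenerate_of_prime)
open Literature.AlgebraicTopology.SingularHomology (singularCohomology)
open Summit.HodgeConjecture.HodgeConjecture.Theses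
open Summit.HodgeConjecture.CorCM.Model

variable {𝒳 S : SchemeOver ℂ} {f : 𝒳 ⟶ S}

/-! ## §1 A stably nondegenerate chart satisfies the Hodge conjecture (fact-free transfers along the chart) -/

section Transfer
variable {d : ℕ}

/-- **A member charted by a STABLY NONDEGENERATE abelian variety satisfies the Hodge conjecture** — unconditionally: `Hdg = Div` on `B`
(the tree's `IsStablyNondegenerate.hodgeConjectureFor`: Lefschetz `(1,1)` and cup products of divisor classes), moved along the chart `B ≅ X_{s₀}`.
[cite: Gordon1999HodgeAVSurvey, Thm. 7.5 (1) and Def. 7.6] [cite: MoonenZarhin1999LowDim, §2 condition (D)] -/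
theorem hodgeConjectureFor_fiberOver_of_isStablyNondegenerate_chart (hf : IsCompactAbelianPencil f d) {s₀ : ComplexPoints S}
    (B : AbelianVariety ℂ) (eB : B.X ≅ fiberOver f s₀) (hB : IsStablyNondegenerate B) : HodgeConjectureFor d (fiberOver f s₀) := by
  have h := hB.hodgeConjectureFor
  rw [Andre1996.compactPencil_dim_eq_of_iso hf eB] at h
  exact (Ring2.Hypotheses.hodgeConjectureFor_iff_of_iso eB).1 h

/-- **A member charted by an abelian variety ISOGENOUS TO A POWER `C^{N+1}` of a stably nondegenerate `C` satisfies the Hodge conjecture**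
(isogeny invariance, van Geemen Lemma 3.7; the tree's `IsStablyNondegenerate.hodgeConjectureFor_of_isIsogenous_powSucc`). Fact-free.
[cite: Gordon1999HodgeAVSurvey, Def. 7.6 and Rem. 7.6.1] [cite: vanGeemen1994HodgeAV, §3.6–3.7 Lemma 3.7] -/
theorem hodgeConjectureFor_fiberOver_of_isIsogenous_powSucc_of_isStablyNondegenerate (hf : IsCompactAbelianPencil f d)
    {s₀ : ComplexPoints S} (B : AbelianVariety ℂ) (eB : B.X ≅ fiberOver f s₀) (C : AbelianVariety ℂ) (N : ℕ)
    (hiso : B.IsIsogenous (C.powSucc N)) (hC : IsStablyNondegenerate C) : HodgeConjectureFor d (fiberOver f s₀) := by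
  have h := hC.hodgeConjectureFor_of_isIsogenous_powSucc hiso
  rw [Andre1996.compactPencil_dim_eq_of_iso hf eB] at h
  exact (Ring2.Hypotheses.hodgeConjectureFor_iff_of_iso eB).1 h

end Transfer

section Anchors
open scoped MonObj

/-- `𝒴` — the fibre square `𝒳 ×_S 𝒳` (display notation for the tree's `familyPullback f f`). -/
local notation3 (prettyPrint := false) "𝒴[" f "]" => familyPullback f f
/-- `𝐚` — the first projection `𝒳 ×_S 𝒳 ⟶ 𝒳`. -/
local notation3 (prettyPrint := false) "𝐚[" f "]" => familyPullback.fst f f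
/-- `𝐛` — the second projection `𝒳 ×_S 𝒳 ⟶ 𝒳`. -/
local notation3 (prettyPrint := false) "𝐛[" f "]" => familyPullback.snd f f

/-! ## §2 General pencils: a stably nondegenerate member is an anchor — the fact-free ⟹ row and the anchored exactness -/

/-- **`B⋆` OF THE TOTAL SPACE PROVES THE HODGE CONJECTURE FOR THE INVARIANT CLASSES OF EVERY MEMBER, through a stably nondegenerate member —
FACT-FREE** (no θ_N, no group law, no Verdier). Compact pencil of abelian `(k+1)`-folds whose total space satisfies `B⋆(𝒳, η)` for every `η`, with a
member `X_{s₀}` charted by a STABLY NONDEGENERATE `B` on which the invariant classes of degrees `2p`, `0 < p < k+1`, are of Hodge type `(p,p)`: then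
`j_s^* W` is ALGEBRAIC on `X_s` for every member `s`, every such `p`, every `W ∈ H^{2p}(𝒳)` — the invariants are algebraic at `s₀` (HC there, part
XLIII-a) and `B⋆` transports algebraicity to every member (part M-c §1: André's regular quasi-inverse, discharged).
[cite: Andre1996Motifs, Prop. 3.3 (pp. 21–22) and §6.3 Remarque 2 (p. 33)] [cite: Gordon1999HodgeAVSurvey, Thm. 7.5 (1) and Def. 7.6]
[cite: DeligneHodgeII1971, Thm. 4.1.1 and Cor. 4.1.2] -/
theorem forall_map_fiberι_mem_algebraicClasses_of_lefschetzB_of_stablyNondegenerateMember {k : ℕ}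
    (hf : IsCompactAbelianPencil f (k + 1)) (hB : ∀ ηX : complexBetti 𝒳 2, StandardConjectureBStar (k + 1 + 1) 𝒳 ηX)
    {s₀ : ComplexPoints S} (B : AbelianVariety ℂ) (eB : B.X ≅ fiberOver f s₀) (hBs : IsStablyNondegenerate B)
    (hHodge : ∀ p : ℕ, 0 < p → p < k + 1 → ∀ W : complexBetti 𝒳 (2 * p),
      IsOfHodgeType (k + 1) (fiberOver f s₀) (2 * p) p p (complexBetti.map (fiberι f s₀) (2 * p) W))
    (s : ComplexPoints S) (p : ℕ) (hp0 : 0 < p) (hp : p < k + 1) (W : complexBetti 𝒳 (2 * p)) :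
    complexBetti.map (fiberι f s) (2 * p) W ∈ algebraicClasses (fiberOver f s) p :=
  map_fiberι_mem_algebraicClasses_of_lefschetzB hf hB (by omega) W
    (forall_map_fiberι_mem_algebraicClasses_of_hodgeConjectureFor_of_isOfHodgeType hf (hHodge p hp0 hp)
      (hodgeConjectureFor_fiberOver_of_isStablyNondegenerate_chart hf B eB hBs) W) s

/-- **ANCHOR = A STABLY NONDEGENERATE MEMBER — NO `HC_CM`.** On a compact pencil of abelian `(k+1)`-folds with θ_N, a group law charted at `t`, no odd
invariants at `t`, and a member `X_{s₀}` charted by a stably nondegenerate `B` (invariants of Hodge type at `s₀`): **`B⋆(𝒳, η) ∀η ⟺` the invariant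
classes are algebraic on EVERY member** (⟸ modulo Verdier). The CM anchors of André's Lemme 6.3.1 need `HC_CM` only when stably degenerate.
[cite: Andre1996Motifs, Lemme 6.3.1 (p. 31) and §6.3 Remarque 2 (p. 33)] [cite: Gordon1999HodgeAVSurvey, Thm. 7.5 (1) and Def. 7.6]
[cite: Tankeev2008, Thm. (i)–(ii)] [cite: Verdier1976, Cor. (5.1)] -/
theorem lefschetzB_pencil_iff_forall_algebraicInvariants_of_stablyNondegenerateMember_of_verdier {k : ℕ}
    (hGT : Verdier1976_genericLocalTriviality) (hf : IsCompactAbelianPencil f (k + 1))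
    (t : ComplexPoints S) (ν : 𝒳 ⟶ 𝒳) (hν : ν ≫ f = f) {N : ℕ} (hN : 2 ≤ N)
    (hθ : ∀ s : ComplexPoints S, ∃ (νs : fiberOver f s ⟶ fiberOver f s) (A : AbelianVariety ℂ) (e : A.X ≅ fiberOver f s),
      νs ≫ fiberι f s = fiberι f s ≫ ν ∧ e.hom ≫ νs = (N • 𝟙 A).hom.hom.hom ≫ e.hom)
    (mS : 𝒴[f] ⟶ 𝒳)
    (hmν : (familyPullback.isPullback f f).lift (𝐚[f] ≫ ν) (𝐛[f] ≫ ν) (familyPullback_pair_condition hν) ≫ mS = mS ≫ ν)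
    (hchart : ∃ (νt : fiberOver f t ⟶ fiberOver f t) (A : AbelianVariety ℂ) (e : A.X ≅ fiberOver f t),
      νt ≫ fiberι f t = fiberι f t ≫ ν ∧ e.hom ≫ νt = (N • 𝟙 A).hom.hom.hom ≫ e.hom ∧
      (familyPullback.isPullback f f).lift (fst A.X A.X ≫ e.hom ≫ fiberι f t) (snd A.X A.X ≫ e.hom ≫ fiberι f t)
        (fibreChart_pair_condition t e) ≫ mS = μ[A.X] ≫ e.hom ≫ fiberι f t)
    (hOdd : ∀ k' : ℕ, Odd k' → k' ≤ 2 * (k + 1) → ∀ W : complexBetti 𝒳 k', complexBetti.map (fiberι f t) k' W = 0)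
    {s₀ : ComplexPoints S} (B : AbelianVariety ℂ) (eB : B.X ≅ fiberOver f s₀) (hBs : IsStablyNondegenerate B)
    (hHodge : ∀ p : ℕ, 0 < p → p < k + 1 → ∀ W : complexBetti 𝒳 (2 * p),
      IsOfHodgeType (k + 1) (fiberOver f s₀) (2 * p) p p (complexBetti.map (fiberι f s₀) (2 * p) W)) :
    (∀ ηX : complexBetti 𝒳 2, StandardConjectureBStar (k + 1 + 1) 𝒳 ηX) ↔
      ∀ (s : ComplexPoints S) (p : ℕ), 0 < p → p < k + 1 → ∀ W : complexBetti 𝒳 (2 * p),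
        complexBetti.map (fiberι f s) (2 * p) W ∈ algebraicClasses (fiberOver f s) p :=
  lefschetzB_pencil_iff_forall_algebraicInvariants_of_hodgeConjectureFor_member_of_verdier hGT hf t ν hν hN hθ mS hmν hchart hOdd hHodge
    (hodgeConjectureFor_fiberOver_of_isStablyNondegenerate_chart hf B eB hBs)

/-- **ANCHOR = A MEMBER ISOGENOUS TO A POWER OF A STABLY NONDEGENERATE ABELIAN VARIETY** (subsumes the elliptic anchors of parts M-c/M-e: an elliptic
curve is stably nondegenerate). Same conclusion: **`B⋆(𝒳, η) ∀η ⟺` the invariant classes are algebraic on EVERY member**, no `HC_CM`.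
[cite: Andre1996Motifs, Lemme 6.3.3 (ii) (p. 33)] [cite: Gordon1999HodgeAVSurvey, Def. 7.6 and Rem. 7.6.1] [cite: vanGeemen1994HodgeAV, Lemma 3.7]
[cite: Tankeev2008, Thm. (i)–(ii)] [cite: Verdier1976, Cor. (5.1)] -/
theorem lefschetzB_pencil_iff_forall_algebraicInvariants_of_isIsogenous_powSucc_stablyNondegenerateMember_of_verdier {k : ℕ}
    (hGT : Verdier1976_genericLocalTriviality) (hf : IsCompactAbelianPencil f (k + 1))
    (t : ComplexPoints S) (ν : 𝒳 ⟶ 𝒳) (hν : ν ≫ f = f) {N : ℕ} (hN : 2 ≤ N)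
    (hθ : ∀ s : ComplexPoints S, ∃ (νs : fiberOver f s ⟶ fiberOver f s) (A : AbelianVariety ℂ) (e : A.X ≅ fiberOver f s),
      νs ≫ fiberι f s = fiberι f s ≫ ν ∧ e.hom ≫ νs = (N • 𝟙 A).hom.hom.hom ≫ e.hom)
    (mS : 𝒴[f] ⟶ 𝒳)
    (hmν : (familyPullback.isPullback f f).lift (𝐚[f] ≫ ν) (𝐛[f] ≫ ν) (familyPullback_pair_condition hν) ≫ mS = mS ≫ ν)
    (hchart : ∃ (νt : fiberOver f t ⟶ fiberOver f t) (A : AbelianVariety ℂ) (e : A.X ≅ fiberOver f t),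
      νt ≫ fiberι f t = fiberι f t ≫ ν ∧ e.hom ≫ νt = (N • 𝟙 A).hom.hom.hom ≫ e.hom ∧
      (familyPullback.isPullback f f).lift (fst A.X A.X ≫ e.hom ≫ fiberι f t) (snd A.X A.X ≫ e.hom ≫ fiberι f t)
        (fibreChart_pair_condition t e) ≫ mS = μ[A.X] ≫ e.hom ≫ fiberι f t)
    (hOdd : ∀ k' : ℕ, Odd k' → k' ≤ 2 * (k + 1) → ∀ W : complexBetti 𝒳 k', complexBetti.map (fiberι f t) k' W = 0)
    {s₀ : ComplexPoints S} (B : AbelianVariety ℂ) (eB : B.X ≅ fiberOver f s₀) (C : AbelianVariety ℂ) (M : ℕ)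
    (hiso : B.IsIsogenous (C.powSucc M)) (hC : IsStablyNondegenerate C)
    (hHodge : ∀ p : ℕ, 0 < p → p < k + 1 → ∀ W : complexBetti 𝒳 (2 * p),
      IsOfHodgeType (k + 1) (fiberOver f s₀) (2 * p) p p (complexBetti.map (fiberι f s₀) (2 * p) W)) :
    (∀ ηX : complexBetti 𝒳 2, StandardConjectureBStar (k + 1 + 1) 𝒳 ηX) ↔
      ∀ (s : ComplexPoints S) (p : ℕ), 0 < p → p < k + 1 → ∀ W : complexBetti 𝒳 (2 * p),
        complexBetti.map (fiberι f s) (2 * p) W ∈ algebraicClasses (fiberOver f s) p :=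
  lefschetzB_pencil_iff_forall_algebraicInvariants_of_hodgeConjectureFor_member_of_verdier hGT hf t ν hν hN hθ mS hmν hchart hOdd hHodge
    (hodgeConjectureFor_fiberOver_of_isIsogenous_powSucc_of_isStablyNondegenerate hf B eB C M hiso hC)

/-! ## §3 Weil pencils with their `K`-action: the fact-free ⟹ row; a stably nondegenerate chart is an anchor -/

/-- **`B⋆` OF THE TOTAL SPACE PROVES THE WEIL HODGE CONJECTURE FOR EVERY MEMBER, through ONE chart satisfying the Hodge conjecture — FACT-FREE.**
Compact pencil `f : 𝒳 ⟶ S` of abelian `(2q+2)`-folds with a global endomorphism `Φ` over `S`, `K`-compatible charts `(A_s, e_s, φ_s)`, `φ_s² = −d_K`,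
a global class `U₊` with `e_t^*(U₊|X_t) ∈ E₊(A_t, φ_t)`, `U₊|X_t ≠ 0` and `(A_t, φ_t)` of Weil type `(q+1, q+1)` at ONE member `t`, and a chart `A_{s₀}`
satisfying the Hodge conjecture. If `B⋆(𝒳, η)` holds for every `η`, then `W(A_s, φ_s) ⊆ N^{q+1}(A_s)` for EVERY member `s`: `(A_{s₀}, φ_{s₀})` is of
Weil type (part L-d), its Weil classes are rational Hodge classes spanning the plane, hence algebraic (HC at `s₀`), so `U₊|X_{s₀}` is algebraic on
`X_{s₀}`; `B⋆` transports this to `U₊|X_s` for every `s` (part M-c §1), and one non-zero algebraic class of the line `E₊(A_s, φ_s)` makes the plane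
algebraic (part M-d §1). No θ_N, no group law, no rank data, no Verdier. [cite: vanGeemen1994HodgeAV, 4.9–4.10 and Lemma 5.2 (6)]
[cite: Deligne1982HodgeCycles, §4 Prop. 4.4] [cite: Andre1996Motifs, Prop. 3.3 (pp. 21–22) and §6.3 Remarque 2 (p. 33)] [cite: DeligneHodgeII1971, (4.1.3.1)] -/
theorem weilClassesOf_le_algebraicClasses_forall_of_lefschetzB_of_hodgeConjectureFor_chart {q dK : ℕ}
    (hf : IsCompactAbelianPencil f (2 * q + 1 + 1)) (hB : ∀ ηX : complexBetti 𝒳 2, StandardConjectureBStar (2 * q + 1 + 1 + 1) 𝒳 ηX)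
    (Φ : 𝒳 ⟶ 𝒳) (hΦ : Φ ≫ f = f)
    (A : ComplexPoints S → AbelianVariety ℂ) (e : ∀ s, (A s).X ≅ fiberOver f s) (φ : ∀ s, A s ⟶ A s)
    (hφ : ∀ s, φ s ≫ φ s = -(dK • 𝟙 (A s)))
    (hK : ∀ s, ∃ Φs : fiberOver f s ⟶ fiberOver f s, Φs ≫ fiberι f s = fiberι f s ≫ Φ ∧ (e s).hom ≫ Φs = (φ s).hom.hom.hom ≫ (e s).hom)
    (Up : complexBetti 𝒳 (2 * (q + 1))) {t : ComplexPoints S}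
    (hUpt : complexBetti.map (e t).hom (2 * (q + 1)) (complexBetti.map (fiberι f t) (2 * (q + 1)) Up) ∈ weilClassesPlus (A t) (φ t) (q + 1) dK)
    (hUp0 : complexBetti.map (fiberι f t) (2 * (q + 1)) Up ≠ 0) (hWt : IsWeilType (A t) (φ t) (q + 1) dK)
    {s₀ : ComplexPoints S} (hHC₀ : HodgeConjectureFor (A s₀).dim (A s₀).X) (s : ComplexPoints S) :
    weilClassesOf (A s) (φ s) (q + 1) dK ≤ algebraicClasses (A s).X (q + 1) := by
  have hUall : ∀ s, complexBetti.map (e s).hom (2 * (q + 1)) (complexBetti.map (fiberι f s) (2 * (q + 1)) Up) ∈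
      weilClassesOf (A s) (φ s) (q + 1) dK := fun s ↦
    Submodule.mem_sup_left (map_chart_fiberι_mem_weilClassesPlus_member_of_member hf Φ hΦ A e φ hK Up hUpt s)
  have hW₀ : IsWeilType (A s₀) (φ s₀) (q + 1) dK := isWeilType_member_of_member hf A e φ hφ Up hUall hWt hUp0 s₀
  have hHC' : HodgeConjectureFor (2 * (q + 1)) (A s₀).X := by rw [← hW₀.dim_eq]; exact hHC₀
  have hWalg₀ : weilClassesOf (A s₀) (φ s₀) (q + 1) dK ≤ algebraicClasses (A s₀).X (q + 1) :=
    weilClassesOf_le_algebraicClasses_of_forall_isRationalClass hW₀.pos hW₀.dim_eq hW₀.d_pos (hφ s₀) hW₀.multiplicity_eq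
      fun c hc hH _ ↦ hHC'.2 (q + 1) c hc hH
  -- `U₊|X_{s₀}` is algebraic on the anchor member
  have ht₀ : complexBetti.map (fiberι f s₀) (2 * (q + 1)) Up ∈ algebraicClasses (fiberOver f s₀) (q + 1) :=
    (mem_algebraicClasses_map_iff_of_iso (e s₀)).1 (hWalg₀ (hUall s₀))
  -- `B⋆` carries it to every member; one algebraic class of the Weil line gives the plane
  exact weilClassesOf_le_algebraicClasses_member_of_map_fiberι_mem hf (by omega) hWt.d_pos Φ hΦ A e φ hφ hK Up hUpt hUp0 s
    (map_fiberι_mem_algebraicClasses_of_lefschetzB hf hB (by omega) Up ht₀ s)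

/-- **The same through a STABLY NONDEGENERATE chart — FACT-FREE and UNCONDITIONAL at the anchor**: `B⋆(𝒳, η) ∀η ⟹ W(A_s, φ_s) ⊆ N^{q+1}(A_s)` for
every member of a compact Weil pencil with its `K`-action one of whose charts `A_{s₀}` is stably nondegenerate (`Hdg = Div` on all its powers).
[cite: Gordon1999HodgeAVSurvey, Thm. 7.5 (1) and Def. 7.6] [cite: vanGeemen1994HodgeAV, 4.9–4.10 and Lemma 5.2 (6)]
[cite: Andre1996Motifs, Prop. 3.3 (pp. 21–22) and §6.3 Remarque 2 (p. 33)] -/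
theorem weilClassesOf_le_algebraicClasses_forall_of_lefschetzB_of_stablyNondegenerateChart {q dK : ℕ}
    (hf : IsCompactAbelianPencil f (2 * q + 1 + 1)) (hB : ∀ ηX : complexBetti 𝒳 2, StandardConjectureBStar (2 * q + 1 + 1 + 1) 𝒳 ηX)
    (Φ : 𝒳 ⟶ 𝒳) (hΦ : Φ ≫ f = f)
    (A : ComplexPoints S → AbelianVariety ℂ) (e : ∀ s, (A s).X ≅ fiberOver f s) (φ : ∀ s, A s ⟶ A s)
    (hφ : ∀ s, φ s ≫ φ s = -(dK • 𝟙 (A s)))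
    (hK : ∀ s, ∃ Φs : fiberOver f s ⟶ fiberOver f s, Φs ≫ fiberι f s = fiberι f s ≫ Φ ∧ (e s).hom ≫ Φs = (φ s).hom.hom.hom ≫ (e s).hom)
    (Up : complexBetti 𝒳 (2 * (q + 1))) {t : ComplexPoints S}
    (hUpt : complexBetti.map (e t).hom (2 * (q + 1)) (complexBetti.map (fiberι f t) (2 * (q + 1)) Up) ∈ weilClassesPlus (A t) (φ t) (q + 1) dK)
    (hUp0 : complexBetti.map (fiberι f t) (2 * (q + 1)) Up ≠ 0) (hWt : IsWeilType (A t) (φ t) (q + 1) dK)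
    {s₀ : ComplexPoints S} (hA₀ : IsStablyNondegenerate (A s₀)) (s : ComplexPoints S) :
    weilClassesOf (A s) (φ s) (q + 1) dK ≤ algebraicClasses (A s).X (q + 1) :=
  weilClassesOf_le_algebraicClasses_forall_of_lefschetzB_of_hodgeConjectureFor_chart hf hB Φ hΦ A e φ hφ hK Up hUpt hUp0 hWt
    hA₀.hodgeConjectureFor s

/-- **ANCHOR = A STABLY NONDEGENERATE CHART, for a compact Weil pencil with its `K`-action** (data of part M-d §2; Weil type at the charted member `t`):
**`B⋆(𝒳, η) ∀η ⟺ W(A_s, φ_s) ⊆ Nⁿ(A_s)` for EVERY member** — no `HC_CM`, no Hodge–Weil theorem in print, Verdier for ⟸ only.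
[cite: Gordon1999HodgeAVSurvey, Thm. 7.5 (1) and Def. 7.6] [cite: vanGeemen1994HodgeAV, 4.9–4.10 and Lemma 5.2 (6)]
[cite: Tankeev2008, Thm. (i)–(ii)] [cite: Verdier1976, Cor. (5.1)] -/
theorem lefschetzB_weilPencil_iff_forall_weilClasses_algebraic_of_stablyNondegenerateChart_of_verdier
    (hGT : Verdier1976_genericLocalTriviality) {q dK : ℕ} (hf : IsCompactAbelianPencil f (2 * q + 1 + 1))
    (t : ComplexPoints S) (ν : 𝒳 ⟶ 𝒳) (hν : ν ≫ f = f) {N : ℕ} (hN : 2 ≤ N)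
    (hθ : ∀ s : ComplexPoints S, ∃ (νs : fiberOver f s ⟶ fiberOver f s) (A : AbelianVariety ℂ) (e : A.X ≅ fiberOver f s),
      νs ≫ fiberι f s = fiberι f s ≫ ν ∧ e.hom ≫ νs = (N • 𝟙 A).hom.hom.hom ≫ e.hom)
    (mS : 𝒴[f] ⟶ 𝒳)
    (hmν : (familyPullback.isPullback f f).lift (𝐚[f] ≫ ν) (𝐛[f] ≫ ν) (familyPullback_pair_condition hν) ≫ mS = mS ≫ ν)
    (hchart : ∃ (νt : fiberOver f t ⟶ fiberOver f t) (A : AbelianVariety ℂ) (e : A.X ≅ fiberOver f t),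
      νt ≫ fiberι f t = fiberι f t ≫ ν ∧ e.hom ≫ νt = (N • 𝟙 A).hom.hom.hom ≫ e.hom ∧
      (familyPullback.isPullback f f).lift (fst A.X A.X ≫ e.hom ≫ fiberι f t) (snd A.X A.X ≫ e.hom ≫ fiberι f t)
        (fibreChart_pair_condition t e) ≫ mS = μ[A.X] ≫ e.hom ≫ fiberι f t)
    (hRank : ∀ p : ℕ, 0 < p → p < 2 * q + 1 + 1 → p ≠ q + 1 →
      Module.finrank ℂ (LinearMap.range (complexBetti.map (fiberι f t) (2 * p)).hom) = 1)
    (hOdd : ∀ k' : ℕ, Odd k' → k' ≤ 2 * (2 * q + 1 + 1) → ∀ W : complexBetti 𝒳 k', complexBetti.map (fiberι f t) k' W = 0)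
    (Φ : 𝒳 ⟶ 𝒳) (hΦ : Φ ≫ f = f)
    (A : ComplexPoints S → AbelianVariety ℂ) (e : ∀ s, (A s).X ≅ fiberOver f s) (φ : ∀ s, A s ⟶ A s)
    (hφ : ∀ s, φ s ≫ φ s = -(dK • 𝟙 (A s)))
    (hK : ∀ s, ∃ Φs : fiberOver f s ⟶ fiberOver f s, Φs ≫ fiberι f s = fiberι f s ≫ Φ ∧ (e s).hom ≫ Φs = (φ s).hom.hom.hom ≫ (e s).hom)
    (Θ Up Um : complexBetti 𝒳 (2 * (q + 1)))
    (hspan : ∀ W : complexBetti 𝒳 (2 * (q + 1)), ∃ a b c : ℂ, (complexBetti.map (fiberι f t) (2 * (q + 1))).hom W =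
      a • (complexBetti.map (fiberι f t) (2 * (q + 1))).hom Θ + b • (complexBetti.map (fiberι f t) (2 * (q + 1))).hom Up +
        c • (complexBetti.map (fiberι f t) (2 * (q + 1))).hom Um)
    (hΘ : ∀ s : ComplexPoints S, (complexBetti.map (fiberι f s) (2 * (q + 1))).hom Θ ∈ algebraicClasses (fiberOver f s) (q + 1))
    (hUpt : complexBetti.map (e t).hom (2 * (q + 1)) (complexBetti.map (fiberι f t) (2 * (q + 1)) Up) ∈ weilClassesPlus (A t) (φ t) (q + 1) dK)
    (hUmt : complexBetti.map (e t).hom (2 * (q + 1)) (complexBetti.map (fiberι f t) (2 * (q + 1)) Um) ∈ weilClassesMinus (A t) (φ t) (q + 1) dK)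
    (hUp0 : complexBetti.map (fiberι f t) (2 * (q + 1)) Up ≠ 0) (hWt : IsWeilType (A t) (φ t) (q + 1) dK)
    {s₀ : ComplexPoints S} (hA₀ : IsStablyNondegenerate (A s₀)) :
    (∀ ηX : complexBetti 𝒳 2, StandardConjectureBStar (2 * q + 1 + 1 + 1) 𝒳 ηX) ↔
      ∀ s : ComplexPoints S, weilClassesOf (A s) (φ s) (q + 1) dK ≤ algebraicClasses (A s).X (q + 1) :=
  lefschetzB_weilPencil_iff_forall_weilClasses_algebraic_of_hodgeConjectureFor_chart_of_verdier hGT hf t ν hν hN hθ mS hmν hchart hRank hOdd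
    Φ hΦ A e φ hφ hK Θ Up Um hspan hΘ hUpt hUmt hUp0 hWt hA₀.hodgeConjectureFor

/-- **ANCHOR = A CHART ISOGENOUS TO A POWER `C^{M+1}` OF A STABLY NONDEGENERATE `C`** (elliptic powers are the case `dim C = 1` of parts M-d/M-e):
**`B⋆(𝒳, η) ∀η ⟺ W(A_s, φ_s) ⊆ Nⁿ(A_s)` for EVERY member**, no `HC_CM`. [cite: Gordon1999HodgeAVSurvey, Def. 7.6 and Rem. 7.6.1]
[cite: vanGeemen1994HodgeAV, Lemma 3.7 and 4.9–4.10] [cite: Tankeev2008, Thm. (i)–(ii)] [cite: Verdier1976, Cor. (5.1)] -/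
theorem lefschetzB_weilPencil_iff_forall_weilClasses_algebraic_of_isIsogenous_powSucc_stablyNondegenerateChart_of_verdier
    (hGT : Verdier1976_genericLocalTriviality) {q dK : ℕ} (hf : IsCompactAbelianPencil f (2 * q + 1 + 1))
    (t : ComplexPoints S) (ν : 𝒳 ⟶ 𝒳) (hν : ν ≫ f = f) {N : ℕ} (hN : 2 ≤ N)
    (hθ : ∀ s : ComplexPoints S, ∃ (νs : fiberOver f s ⟶ fiberOver f s) (A : AbelianVariety ℂ) (e : A.X ≅ fiberOver f s),
      νs ≫ fiberι f s = fiberι f s ≫ ν ∧ e.hom ≫ νs = (N • 𝟙 A).hom.hom.hom ≫ e.hom)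
    (mS : 𝒴[f] ⟶ 𝒳)
    (hmν : (familyPullback.isPullback f f).lift (𝐚[f] ≫ ν) (𝐛[f] ≫ ν) (familyPullback_pair_condition hν) ≫ mS = mS ≫ ν)
    (hchart : ∃ (νt : fiberOver f t ⟶ fiberOver f t) (A : AbelianVariety ℂ) (e : A.X ≅ fiberOver f t),
      νt ≫ fiberι f t = fiberι f t ≫ ν ∧ e.hom ≫ νt = (N • 𝟙 A).hom.hom.hom ≫ e.hom ∧
      (familyPullback.isPullback f f).lift (fst A.X A.X ≫ e.hom ≫ fiberι f t) (snd A.X A.X ≫ e.hom ≫ fiberι f t)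
        (fibreChart_pair_condition t e) ≫ mS = μ[A.X] ≫ e.hom ≫ fiberι f t)
    (hRank : ∀ p : ℕ, 0 < p → p < 2 * q + 1 + 1 → p ≠ q + 1 →
      Module.finrank ℂ (LinearMap.range (complexBetti.map (fiberι f t) (2 * p)).hom) = 1)
    (hOdd : ∀ k' : ℕ, Odd k' → k' ≤ 2 * (2 * q + 1 + 1) → ∀ W : complexBetti 𝒳 k', complexBetti.map (fiberι f t) k' W = 0)
    (Φ : 𝒳 ⟶ 𝒳) (hΦ : Φ ≫ f = f)
    (A : ComplexPoints S → AbelianVariety ℂ) (e : ∀ s, (A s).X ≅ fiberOver f s) (φ : ∀ s, A s ⟶ A s)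
    (hφ : ∀ s, φ s ≫ φ s = -(dK • 𝟙 (A s)))
    (hK : ∀ s, ∃ Φs : fiberOver f s ⟶ fiberOver f s, Φs ≫ fiberι f s = fiberι f s ≫ Φ ∧ (e s).hom ≫ Φs = (φ s).hom.hom.hom ≫ (e s).hom)
    (Θ Up Um : complexBetti 𝒳 (2 * (q + 1)))
    (hspan : ∀ W : complexBetti 𝒳 (2 * (q + 1)), ∃ a b c : ℂ, (complexBetti.map (fiberι f t) (2 * (q + 1))).hom W =
      a • (complexBetti.map (fiberι f t) (2 * (q + 1))).hom Θ + b • (complexBetti.map (fiberι f t) (2 * (q + 1))).hom Up +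
        c • (complexBetti.map (fiberι f t) (2 * (q + 1))).hom Um)
    (hΘ : ∀ s : ComplexPoints S, (complexBetti.map (fiberι f s) (2 * (q + 1))).hom Θ ∈ algebraicClasses (fiberOver f s) (q + 1))
    (hUpt : complexBetti.map (e t).hom (2 * (q + 1)) (complexBetti.map (fiberι f t) (2 * (q + 1)) Up) ∈ weilClassesPlus (A t) (φ t) (q + 1) dK)
    (hUmt : complexBetti.map (e t).hom (2 * (q + 1)) (complexBetti.map (fiberι f t) (2 * (q + 1)) Um) ∈ weilClassesMinus (A t) (φ t) (q + 1) dK)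
    (hUp0 : complexBetti.map (fiberι f t) (2 * (q + 1)) Up ≠ 0) (hWt : IsWeilType (A t) (φ t) (q + 1) dK)
    {s₀ : ComplexPoints S} (C : AbelianVariety ℂ) (M : ℕ) (hiso : (A s₀).IsIsogenous (C.powSucc M)) (hC : IsStablyNondegenerate C) :
    (∀ ηX : complexBetti 𝒳 2, StandardConjectureBStar (2 * q + 1 + 1 + 1) 𝒳 ηX) ↔
      ∀ s : ComplexPoints S, weilClassesOf (A s) (φ s) (q + 1) dK ≤ algebraicClasses (A s).X (q + 1) :=
  lefschetzB_weilPencil_iff_forall_weilClasses_algebraic_of_hodgeConjectureFor_chart_of_verdier hGT hf t ν hν hN hθ mS hmν hchart hRank hOdd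
    Φ hΦ A e φ hφ hK Θ Up Um hspan hΘ hUpt hUmt hUp0 hWt (hC.hodgeConjectureFor_of_isIsogenous_powSucc hiso)

/-! ## §4 The instance: charts isogenous to a power of a PRIME-dimensional abelian variety with a CM field of full degree (Tankeev–Ribet–Yanai) -/

/-- **ANCHOR = A CHART ISOGENOUS TO `P^{M+1}`, `P` OF PRIME DIMENSION `p` WITH A NUMBER FIELD OF DEGREE `2p` IN `End_ℚ(P)`** — e.g. `B × B̄ ≅ B²` for a
simple CM abelian threefold `B`, the sister cell's non-split sixfold anchors; `Eᵖ`-type charts. `P` is stably nondegenerate UNCONDITIONALLY (the tree's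
`EndFieldFullDegree.isStablyNondegenerate_of_prime`: Yanai's nondegeneracy of primitive types in prime dimension + Hazama, or `P ∼ Eᵖ` and
Tate–Murasaki; no simplicity hypothesis), so for a compact Weil pencil with its `K`-action through such a chart **`B⋆(𝒳, η) ∀η ⟺ W(A_s, φ_s) ⊆ Nⁿ(A_s)`
for EVERY member** — no `HC_CM`, no Hodge–Weil theorem in print; Verdier for ⟸. [cite: Gordon1999HodgeAVSurvey, Thm. 6.3 with Remark, Thm. 6.4 and §3 Theorem]
[cite: Yanai1985, Remark (p. 172)] [cite: vanGeemen1994HodgeAV, Lemma 3.7 and 4.9–4.10] [cite: Tankeev2008, Thm. (i)–(ii)] [cite: Verdier1976, Cor. (5.1)] -/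
theorem lefschetzB_weilPencil_iff_forall_weilClasses_algebraic_of_primeCMPowerChart_of_verdier
    (hGT : Verdier1976_genericLocalTriviality) {q dK : ℕ} (hf : IsCompactAbelianPencil f (2 * q + 1 + 1))
    (t : ComplexPoints S) (ν : 𝒳 ⟶ 𝒳) (hν : ν ≫ f = f) {N : ℕ} (hN : 2 ≤ N)
    (hθ : ∀ s : ComplexPoints S, ∃ (νs : fiberOver f s ⟶ fiberOver f s) (A : AbelianVariety ℂ) (e : A.X ≅ fiberOver f s),
      νs ≫ fiberι f s = fiberι f s ≫ ν ∧ e.hom ≫ νs = (N • 𝟙 A).hom.hom.hom ≫ e.hom)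
    (mS : 𝒴[f] ⟶ 𝒳)
    (hmν : (familyPullback.isPullback f f).lift (𝐚[f] ≫ ν) (𝐛[f] ≫ ν) (familyPullback_pair_condition hν) ≫ mS = mS ≫ ν)
    (hchart : ∃ (νt : fiberOver f t ⟶ fiberOver f t) (A : AbelianVariety ℂ) (e : A.X ≅ fiberOver f t),
      νt ≫ fiberι f t = fiberι f t ≫ ν ∧ e.hom ≫ νt = (N • 𝟙 A).hom.hom.hom ≫ e.hom ∧
      (familyPullback.isPullback f f).lift (fst A.X A.X ≫ e.hom ≫ fiberι f t) (snd A.X A.X ≫ e.hom ≫ fiberι f t)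
        (fibreChart_pair_condition t e) ≫ mS = μ[A.X] ≫ e.hom ≫ fiberι f t)
    (hRank : ∀ p : ℕ, 0 < p → p < 2 * q + 1 + 1 → p ≠ q + 1 →
      Module.finrank ℂ (LinearMap.range (complexBetti.map (fiberι f t) (2 * p)).hom) = 1)
    (hOdd : ∀ k' : ℕ, Odd k' → k' ≤ 2 * (2 * q + 1 + 1) → ∀ W : complexBetti 𝒳 k', complexBetti.map (fiberι f t) k' W = 0)
    (Φ : 𝒳 ⟶ 𝒳) (hΦ : Φ ≫ f = f)
    (A : ComplexPoints S → AbelianVariety ℂ) (e : ∀ s, (A s).X ≅ fiberOver f s) (φ : ∀ s, A s ⟶ A s)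
    (hφ : ∀ s, φ s ≫ φ s = -(dK • 𝟙 (A s)))
    (hK : ∀ s, ∃ Φs : fiberOver f s ⟶ fiberOver f s, Φs ≫ fiberι f s = fiberι f s ≫ Φ ∧ (e s).hom ≫ Φs = (φ s).hom.hom.hom ≫ (e s).hom)
    (Θ Up Um : complexBetti 𝒳 (2 * (q + 1)))
    (hspan : ∀ W : complexBetti 𝒳 (2 * (q + 1)), ∃ a b c : ℂ, (complexBetti.map (fiberι f t) (2 * (q + 1))).hom W =
      a • (complexBetti.map (fiberι f t) (2 * (q + 1))).hom Θ + b • (complexBetti.map (fiberι f t) (2 * (q + 1))).hom Up +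
        c • (complexBetti.map (fiberι f t) (2 * (q + 1))).hom Um)
    (hΘ : ∀ s : ComplexPoints S, (complexBetti.map (fiberι f s) (2 * (q + 1))).hom Θ ∈ algebraicClasses (fiberOver f s) (q + 1))
    (hUpt : complexBetti.map (e t).hom (2 * (q + 1)) (complexBetti.map (fiberι f t) (2 * (q + 1)) Up) ∈ weilClassesPlus (A t) (φ t) (q + 1) dK)
    (hUmt : complexBetti.map (e t).hom (2 * (q + 1)) (complexBetti.map (fiberι f t) (2 * (q + 1)) Um) ∈ weilClassesMinus (A t) (φ t) (q + 1) dK)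
    (hUp0 : complexBetti.map (fiberι f t) (2 * (q + 1)) Up ≠ 0) (hWt : IsWeilType (A t) (φ t) (q + 1) dK)
    {s₀ : ComplexPoints S} {P : AbelianVariety ℂ} {F : Type} [Field F] [NumberField F]
    (ιF : F →+* P.endAlgebra) (hF : Module.finrank ℚ F = 2 * P.dim) (hp : P.dim.Prime) (M : ℕ) (hiso : (A s₀).IsIsogenous (P.powSucc M)) :
    (∀ ηX : complexBetti 𝒳 2, StandardConjectureBStar (2 * q + 1 + 1 + 1) 𝒳 ηX) ↔
      ∀ s : ComplexPoints S, weilClassesOf (A s) (φ s) (q + 1) dK ≤ algebraicClasses (A s).X (q + 1) :=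
  lefschetzB_weilPencil_iff_forall_weilClasses_algebraic_of_isIsogenous_powSucc_stablyNondegenerateChart_of_verdier hGT hf t ν hν hN hθ mS hmν
    hchart hRank hOdd Φ hΦ A e φ hφ hK Θ Up Um hspan hΘ hUpt hUmt hUp0 hWt P M hiso
    (EndFieldFullDegree.isStablyNondegenerate_of_prime ιF hF hp)

/-- **THE FACT-FREE ⟹ ROW AT A PRIME-DIMENSIONAL CM ANCHOR: `B⋆` of the total space of ONE compact Weil pencil with its `K`-action through a chart
isogenous to `P^{M+1}` (`P` of prime dimension with a number field of degree `2 dim P` in `End_ℚ(P)`) ⟹ the Weil Hodge conjecture `W(A_s, φ_s) ⊆ Nⁿ(A_s)`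
for EVERY member** — no `HC_CM`, no Verdier, no Hodge–Weil theorem in print, no θ_N / group law / rank data. Neither side claimed.
[cite: Gordon1999HodgeAVSurvey, Thm. 6.3 with Remark, Thm. 6.4 and §3 Theorem] [cite: Yanai1985, Remark (p. 172)]
[cite: vanGeemen1994HodgeAV, Lemma 3.7, 4.9–4.10 and Lemma 5.2 (6)] [cite: Andre1996Motifs, Prop. 3.3 (pp. 21–22) and §6.3 Remarque 2 (p. 33)] -/
theorem weilClassesOf_le_algebraicClasses_forall_of_lefschetzB_of_primeCMPowerChart {q dK : ℕ}
    (hf : IsCompactAbelianPencil f (2 * q + 1 + 1)) (hB : ∀ ηX : complexBetti 𝒳 2, StandardConjectureBStar (2 * q + 1 + 1 + 1) 𝒳 ηX)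
    (Φ : 𝒳 ⟶ 𝒳) (hΦ : Φ ≫ f = f)
    (A : ComplexPoints S → AbelianVariety ℂ) (e : ∀ s, (A s).X ≅ fiberOver f s) (φ : ∀ s, A s ⟶ A s)
    (hφ : ∀ s, φ s ≫ φ s = -(dK • 𝟙 (A s)))
    (hK : ∀ s, ∃ Φs : fiberOver f s ⟶ fiberOver f s, Φs ≫ fiberι f s = fiberι f s ≫ Φ ∧ (e s).hom ≫ Φs = (φ s).hom.hom.hom ≫ (e s).hom)
    (Up : complexBetti 𝒳 (2 * (q + 1))) {t : ComplexPoints S}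
    (hUpt : complexBetti.map (e t).hom (2 * (q + 1)) (complexBetti.map (fiberι f t) (2 * (q + 1)) Up) ∈ weilClassesPlus (A t) (φ t) (q + 1) dK)
    (hUp0 : complexBetti.map (fiberι f t) (2 * (q + 1)) Up ≠ 0) (hWt : IsWeilType (A t) (φ t) (q + 1) dK)
    {s₀ : ComplexPoints S} {P : AbelianVariety ℂ} {F : Type} [Field F] [NumberField F]
    (ιF : F →+* P.endAlgebra) (hF : Module.finrank ℚ F = 2 * P.dim) (hp : P.dim.Prime) (M : ℕ) (hiso : (A s₀).IsIsogenous (P.powSucc M))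
    (s : ComplexPoints S) : weilClassesOf (A s) (φ s) (q + 1) dK ≤ algebraicClasses (A s).X (q + 1) :=
  weilClassesOf_le_algebraicClasses_forall_of_lefschetzB_of_hodgeConjectureFor_chart hf hB Φ hΦ A e φ hφ hK Up hUpt hUp0 hWt
    ((EndFieldFullDegree.isStablyNondegenerate_of_prime ιF hF hp).hodgeConjectureFor_of_isIsogenous_powSucc hiso) s

/-- **General pencils through a member isogenous to a power of a prime-dimensional `P` with a CM field of full degree** (θ_N, group law, no odd
invariants, invariants of Hodge type at `s₀`): **`B⋆(𝒳, η) ∀η ⟺` the invariant classes are algebraic on EVERY member**, no `HC_CM`.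
[cite: Gordon1999HodgeAVSurvey, Thm. 6.3 with Remark and Thm. 6.4] [cite: Yanai1985, Remark (p. 172)] [cite: Andre1996Motifs, Lemme 6.3.1 and Lemme 6.3.3 (p. 31, 33)]
[cite: Tankeev2008, Thm. (i)–(ii)] [cite: Verdier1976, Cor. (5.1)] -/
theorem lefschetzB_pencil_iff_forall_algebraicInvariants_of_primeCMPowerMember_of_verdier {k : ℕ}
    (hGT : Verdier1976_genericLocalTriviality) (hf : IsCompactAbelianPencil f (k + 1))
    (t : ComplexPoints S) (ν : 𝒳 ⟶ 𝒳) (hν : ν ≫ f = f) {N : ℕ} (hN : 2 ≤ N)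
    (hθ : ∀ s : ComplexPoints S, ∃ (νs : fiberOver f s ⟶ fiberOver f s) (A : AbelianVariety ℂ) (e : A.X ≅ fiberOver f s),
      νs ≫ fiberι f s = fiberι f s ≫ ν ∧ e.hom ≫ νs = (N • 𝟙 A).hom.hom.hom ≫ e.hom)
    (mS : 𝒴[f] ⟶ 𝒳)
    (hmν : (familyPullback.isPullback f f).lift (𝐚[f] ≫ ν) (𝐛[f] ≫ ν) (familyPullback_pair_condition hν) ≫ mS = mS ≫ ν)
    (hchart : ∃ (νt : fiberOver f t ⟶ fiberOver f t) (A : AbelianVariety ℂ) (e : A.X ≅ fiberOver f t),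
      νt ≫ fiberι f t = fiberι f t ≫ ν ∧ e.hom ≫ νt = (N • 𝟙 A).hom.hom.hom ≫ e.hom ∧
      (familyPullback.isPullback f f).lift (fst A.X A.X ≫ e.hom ≫ fiberι f t) (snd A.X A.X ≫ e.hom ≫ fiberι f t)
        (fibreChart_pair_condition t e) ≫ mS = μ[A.X] ≫ e.hom ≫ fiberι f t)
    (hOdd : ∀ k' : ℕ, Odd k' → k' ≤ 2 * (k + 1) → ∀ W : complexBetti 𝒳 k', complexBetti.map (fiberι f t) k' W = 0)
    {s₀ : ComplexPoints S} (B : AbelianVariety ℂ) (eB : B.X ≅ fiberOver f s₀) {P : AbelianVariety ℂ} {F : Type} [Field F] [NumberField F]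
    (ιF : F →+* P.endAlgebra) (hF : Module.finrank ℚ F = 2 * P.dim) (hp : P.dim.Prime) (M : ℕ) (hiso : B.IsIsogenous (P.powSucc M))
    (hHodge : ∀ p : ℕ, 0 < p → p < k + 1 → ∀ W : complexBetti 𝒳 (2 * p),
      IsOfHodgeType (k + 1) (fiberOver f s₀) (2 * p) p p (complexBetti.map (fiberι f s₀) (2 * p) W)) :
    (∀ ηX : complexBetti 𝒳 2, StandardConjectureBStar (k + 1 + 1) 𝒳 ηX) ↔
      ∀ (s : ComplexPoints S) (p : ℕ), 0 < p → p < k + 1 → ∀ W : complexBetti 𝒳 (2 * p),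
        complexBetti.map (fiberι f s) (2 * p) W ∈ algebraicClasses (fiberOver f s) p :=
  lefschetzB_pencil_iff_forall_algebraicInvariants_of_isIsogenous_powSucc_stablyNondegenerateMember_of_verdier hGT hf t ν hν hN hθ mS hmν
    hchart hOdd B eB P M hiso (EndFieldFullDegree.isStablyNondegenerate_of_prime ιF hF hp) hHodge

end Anchors

end Summit.HodgeConjecture.HodgeConjecture.Ring2.AbelianAll

end
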